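import Mathlib
import Summits.Ventures.FusionMHD.Models.CerfonFreidbergIterLikeQHalfShearDefs
import HarnessLib

/-!
# Ventures/FusionMHD — Models/CerfonFreidbergIterLikeQHalfShearPanels5.lean: KERNEL CHECK of the shear-register certificates of panels 8, 9 (of 32)
# at `ψ_N = 1/2` of THE Cerfon–Freidberg ITER-like instance

HONEST FRAMING (LADDER-GRIDFUSION three columns; CF rung; successor step of «q′(ψ_N = 1/2) on the CF rung», F2-SCOPING v1.6 §10(c)).  One `decide +kernel`
(≈ 80 s): for each listed panel the obligation `CFIterLike.QHalfShear.ShearCert.ok` (`Models/CerfonFreidbergIterLikeQHalfShearDefs.lean`) — the Taylor-model run of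
`progQ = CFIterLike.QHalf.progA ++ blockQ` over ★ #117's parameter box is ACCEPTED and the kernel's panel-integral enclosure of the shear kernel `K·p` along the
approximant lies inside the claimed integers (read off a compiled `#eval` of the same functions, slack one unit of `2⁻⁶⁰`; float truth inside every panel).
MODELLED: analytic Cerfon–Freidberg family; nothing about a device or stability.  No `native_decide`.  Typer/prover: gridfusion-model-5 (g8), 2026-08-27.
Citations: Freidberg 2014 §6.3.5 (6.35) [Freidberg2014]; Mahboubi–Melquiond–Sibut-Pinote 2016 §3.2 Lemma 3 [MahboubiMelquiondSibutpinote2016].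
-/

namespace Summit.Ventures.FusionMHD.Models.CFIterLike.QHalfShear

/-- Shear-register certificate data of panels 8, 9. [instance data] -/
def shearCert5 : List ShearCert := [
  { j := 8, cand := [158496805499783020544, 663520553161065496576, 3039845335214825406464, 10748111537424570515456, 36446900560227727310848, 110102759763644109553664, 303144642662317688881152, 733841255452028776218624, 1859425307017296052486144, 7713767309935848227602432, -1351913904565893196920389632, -8548486300041364998857949184, 1853274126852628212023266639872],
    deg := 10, elog2 := 42, plo := -1375427341430659276, phi := -1375427215755039221 },
  { j := 9, cand := [182566773043458637824, 890032960413561520128, 4299475765893267980288, 16591430553058200780800, 58983815000806788169728, 184804149041724154445824, 509424998792220213510144, 1163414803447365417041920, 1832405513995110972391424, 8194942457563793552572416, -18707976770991115508645888, -11831022624346556286566924288, 12278856055515262892552224768],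
    deg := 10, elog2 := 43, plo := -1494092429729633614, phi := -1494092228359681549 }]

/-- **KERNEL CHECK** of the shear register on panels 8, 9. -/
theorem shearCert5_ok : CFIterLike.QHalfShear.shearCert5.all ShearCert.ok = true := by
  decide +kernel

end Summit.Ventures.FusionMHD.Models.CFIterLike.QHalfShear
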